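import Literature.Probability.Percolation.ZdFiveArmPointBoundOfSeparation
import Literature.Probability.Percolation.ZdFiveArmSeparatedE
import Literature.Probability.Percolation.ZdFiveArmKSZ3
import HarnessLib

/-!
# The point upper bound `(U)` of the five-arm probability on `ℤ²` from separation with EDGE-disjoint right arms

Topic `Literature/Probability/Percolation`; critical bond percolation on `ℤ²`.  This file re-derives
the conditional theorem `zdFiveArm_pointBound_of_separation` of `ZdFiveArmPointBoundOfSeparation.lean`
(KSZ 1998, Lemma 5 / Nolin 2008, Thm. 24 (3): `P(zdFiveArmClusters k N) ≤ C / N²` from Kesten's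
arm-separation lower bound) from the WEAKER and honest separation hypothesis

  `hsepE : ∃ c > 0, ∃ n₀, ∀ n N, n₀ ≤ n → 2n ≤ N → c · P(zdFiveArmClusters n N) ≤ P(zdFiveArmSepE n N)`,

in which the two fenced right arms of the separated event are only asked to be EDGE-disjoint
(`zdFiveArmSepE`, `ZdFiveArmSeparatedE.lean`), exactly as the third arm of `zdFiveArmClusters` is only
edge-disjoint from the other two and exactly as Kesten's construction (Kesten 1987, Lemma 4; Nolin
2008, Thm. 11 and Lemma 15 [arXiv: Thm. 10, Lemma 14]) delivers them.  The whole construction of the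
parent file is reused (hub, corridors, pair sets, geometry, RSW/FKG bounds, gluing, translation); the
one new ingredient is the uniqueness of KSZ's landed event for edge-disjoint right arms when the
centre has a closed incident edge (`zdFiveArmKSZ3`, `ZdFiveArmKSZ3.lean`): the origin of the hub has
exactly three open edges (the edge `{(0,0), (1,0)}` is a forced closed pair of the hub).

* `uGluedE` — the glued event with `zdFiveArmSepE`; `real_uGluedE_ge` — its probability
  (generalised FKG, RSW at aspect ratio `1024`, Harris, independence of the hub);
* `uGluedE_openArms` — the three extended open arms, the two right ones EDGE-disjoint;
  `uGlued_dualArms_of_parts` — the two extended dual arms (the statement of `uGlued_dualArms` from its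
  actual ingredients); `not_mem_of_mem_zdHub_origin_right` — the closed edge at the origin;
* `mem_zdFiveArmKSZ3_of_arms`, `relabel_shift_mem_zdFiveArmKSZ3_of_mem_uGluedE` — the glued event is a
  translate of `zdFiveArmKSZ3 (8N) (8N) v`;
* `real_zdFiveArmSepE_mul_le_one` — KSZ's counting `(2N+1)² · const_k · P(zdFiveArmSepE k N) ≤ 1`;
* `zdFiveArm_pointBound_of_separationE` — **`(U)` from `hsepE`**.

No named fact is introduced; the separation theorem enters only as the hypothesis `hsepE`.

## References

* H. Kesten, *Scaling relations for 2D-percolation*, CMP 109 (1987), Lemma 4, Lemma 6, (2.43)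
  [KestenScalingCMP1987].
* H. Kesten, V. Sidoravicius, Y. Zhang, EJP 3 (1998), Lemma 5, (3.10)–(3.11)
  [KestenSidoraviciusZhang1998].
* P. Nolin, EJP 13 (2008), §4.3 Prop. 12, Lemma 13; §4.5 Prop. 17; §5.2 Thm. 24 [Nolin2008].
* D. Chelkak, H. Duminil-Copin, C. Hongler, EJP 21 (2016), §5.2 [ChelkakDuminilCopinHongler2016].

Tree: `ZdFiveArmPointBoundOfSeparation.lean` (everything), `ZdFiveArmSeparatedE.lean`,
`ZdFiveArmKSZ3.lean`, `ZdFiveArmKSZOfArms.lean` (`ZdFiveArmKSZ.exists_cornerWalk`,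
`ZdFiveArmKSZ.cornerFaces_bounds`), `BondLocallyMonotoneFKG.lean`, `RSWLemma.lean`,
`BondPercolationSymmetry.lean`.
-/

noncomputable section

open Set _root_.MeasureTheory

namespace Literature.Probability.Percolation

open LatticeModels SimpleGraph

/-! ### Gluing with edge bookkeeping, re-typed; composition of arms with edges -/

section GlueE

/-- Outer gluing, right arm, with general landing parameters and edge bookkeeping (re-typed).
[folklore] -/
theorem ZdSepOpenArmR.exists_walk_of_outerCorridorE' {ω : BondConfig (Site 2)} {n N : ℕ} {lo hi lo' hi' : ℤ}
    {s y : Site 2} (A : ZdSepOpenArmR ω n N lo hi lo' hi') (hhi' : hi' = lo' + (N / 64 : ℕ))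
    (hE : 1 ≤ N / 8) (T : (zdGraph 2).Walk s y) (hs : s 0 = N + 1) (hy : (N : ℤ) + (N / 8 : ℕ) ≤ y 0)
    (hT : ∀ z ∈ T.support, (N : ℤ) + 1 ≤ z 0 ∧ (z 0 ≤ N + (N / 8 : ℕ) → lo' ≤ z 1 ∧ z 1 ≤ lo' + (N / 64 : ℕ))) :
    ∃ m ∈ T.support, ∃ U : (zdGraph 2).Walk A.x m,
      (∀ z ∈ U.support, z ∈ A.carrier) ∧ (∀ e ∈ U.edges, e ∈ A.edgeCarrier) ∧ ∀ e ∈ U.edges, e ∈ ω := by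
  subst hhi'; exact A.exists_walk_of_outerCorridorE hE T hs hy hT

/-- Inner gluing, right arm, with general landing parameters and edge bookkeeping (re-typed).
[folklore] -/
theorem ZdSepOpenArmR.exists_walk_of_innerCorridorE' {ω : BondConfig (Site 2)} {n N : ℕ} {lo hi lo' hi' : ℤ}
    {s y : Site 2} (A : ZdSepOpenArmR ω n N lo hi lo' hi') (hhi : hi = lo + (n / 64 : ℕ))
    (he : 1 ≤ n / 8) (T : (zdGraph 2).Walk s y) (hy : y 0 + 1 = n) (hs : s 0 ≤ (n : ℤ) - (n / 8 : ℕ))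
    (hT : ∀ z ∈ T.support, z 0 + 1 ≤ n ∧ ((n : ℤ) - (n / 8 : ℕ) ≤ z 0 → lo ≤ z 1 ∧ z 1 ≤ lo + (n / 64 : ℕ))) :
    ∃ m ∈ T.support, ∃ U : (zdGraph 2).Walk A.x m,
      (∀ z ∈ U.support, z ∈ A.carrier) ∧ (∀ e ∈ U.edges, e ∈ A.edgeCarrier) ∧ ∀ e ∈ U.edges, e ∈ ω := by
  subst hhi; exact A.exists_walk_of_innerCorridorE he T hy hs hT

/-- **Composition of an extended arm, with edges**: hub walk, inner corridor up to its meeting point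
with the inner gluing walk, inner gluing walk (reversed), outer gluing walk, outer corridor from its
meeting point on; every vertex and every EDGE of the composite comes from one of the five pieces.
[folklore] -/
theorem exists_composedArmE {ω : BondConfig (Site 2)} {c tip yi x mi mo so yo : Site 2}
    (HW : (zdGraph 2).Walk c tip) (Ti : (zdGraph 2).Walk tip yi) (hmi : mi ∈ Ti.support)
    (Ui : (zdGraph 2).Walk x mi) (Uo : (zdGraph 2).Walk x mo) (To : (zdGraph 2).Walk so yo) (hmo : mo ∈ To.support)
    (h1 : ∀ e ∈ HW.edges, e ∈ ω) (h2 : ∀ e ∈ Ti.edges, e ∈ ω) (h3 : ∀ e ∈ Ui.edges, e ∈ ω)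
    (h4 : ∀ e ∈ Uo.edges, e ∈ ω) (h5 : ∀ e ∈ To.edges, e ∈ ω) :
    ∃ P : (zdGraph 2).Walk c yo, (∀ e ∈ P.edges, e ∈ ω) ∧
      (∀ z ∈ P.support, z ∈ HW.support ∨ z ∈ Ti.support ∨ z ∈ Ui.support ∨ z ∈ Uo.support ∨ z ∈ To.support) ∧
      ∀ e ∈ P.edges, e ∈ HW.edges ∨ e ∈ Ti.edges ∨ e ∈ Ui.edges ∨ e ∈ Uo.edges ∨ e ∈ To.edges := by
  refine ⟨HW.append ((Ti.takeUntil mi hmi).append (Ui.reverse.append (Uo.append (To.dropUntil mo hmo)))),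
    fun e he => ?_, fun z hz => ?_, fun e he => ?_⟩
  · simp only [Walk.edges_append, List.mem_append, Walk.edges_reverse, List.mem_reverse] at he
    rcases he with he | he | he | he | he
    · exact h1 e he
    · exact h2 e (Ti.edges_takeUntil_subset_edges hmi he)
    · exact h3 e he
    · exact h4 e he
    · exact h5 e (To.edges_dropUntil_subset_edges hmo he)
  · simp only [Walk.mem_support_append_iff, Walk.support_reverse, List.mem_reverse] at hz
    rcases hz with hz | hz | hz | hz | hz
    · exact Or.inl hz
    · exact Or.inr (Or.inl (Ti.support_takeUntil_subset_support hmi hz))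
    · exact Or.inr (Or.inr (Or.inl hz))
    · exact Or.inr (Or.inr (Or.inr (Or.inl hz)))
    · exact Or.inr (Or.inr (Or.inr (Or.inr (To.support_dropUntil_subset_support hmo hz))))
  · simp only [Walk.edges_append, List.mem_append, Walk.edges_reverse, List.mem_reverse] at he
    rcases he with he | he | he | he | he
    · exact Or.inl he
    · exact Or.inr (Or.inl (Ti.edges_takeUntil_subset_edges hmi he))
    · exact Or.inr (Or.inr (Or.inl he))
    · exact Or.inr (Or.inr (Or.inr (Or.inl he)))
    · exact Or.inr (Or.inr (Or.inr (Or.inr (To.edges_dropUntil_subset_edges hmo he))))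

end GlueE

/-! ### The glued event with `zdFiveArmSepE` and its probability -/

section UProbabilityE

open scoped Classical

variable (k N WL ER SB NT : ℕ)

/-- **The glued event of `(U)`, edge-disjoint form**: the well-separated five arms with edge-disjoint
right arms at scales `k ≤ N`, the ten corridors with the two closed rows, and the hub. [cite: Nolin2008, §4.3, Prop. 12 and §4.5, Prop. 17] -/
def uGluedE : Set (BondConfig (Site 2)) :=
  zdFiveArmSepE k N ∩ (uCorrOpen k N WL ER ∩ uCorrDual k N SB NT) ∩ zdHub (k / 2 - 1) (k / 4) (k / 64)

variable {k N WL ER SB NT}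

/-- **The probability of the glued event, edge-disjoint form** (Kesten 1987, Lemma 6 with (2.43); Nolin 2008,
Prop. 12 and Prop. 17): by the generalised FKG inequality (the arms being determined by the zones,
the corridors by disjoint pair sets), RSW in the ten corridors, the two closed rows, and the hub
(independent of everything else),
`P(uGlued) ≥ c¹⁰ · 2^{-2(k/64+1)} · 2^{-|hubPairs|} · P(zdFiveArmSepE k N)`. [cite: Nolin2008, §4.3, Prop. 12 (i)] -/
theorem real_uGluedE_ge (hk : 128 ≤ k) (hN : 2 * k ≤ N) (hWL : 3 * N ≤ WL) (hWL' : WL ≤ 5 * N)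
    (hER : 3 * N ≤ ER) (hER' : ER ≤ 5 * N) (hSB : 3 * N ≤ SB) (hSB' : SB ≤ 5 * N) (hNT' : NT ≤ 5 * N)
    {c : ℝ} (hc0 : 0 < c) (hc : ∀ l : ℕ, 1 ≤ l → c ≤ crossingProb half (1024 * l - 1) (l - 1)) :
    c ^ 10 * (1 / 2 : ℝ) ^ (2 * (k / 64 + 1)) * (1 / 2 : ℝ) ^ (hubPairs (k / 2 - 1)).card *
        (bondPercolation (zdGraph 2) half).real (zdFiveArmSepE k N) ≤
      (bondPercolation (zdGraph 2) half).real (uGluedE k N WL ER SB NT) := by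
  set μ := bondPercolation (zdGraph 2) half with hμ
  -- the generalised FKG inequality
  have hSP : Disjoint (uPairsS k N WL ER SB NT) (uPairsP k N WL ER) :=
    disjoint_sdiff_self_left.mono_right le_sup_left
  have hSM : Disjoint (uPairsS k N WL ER SB NT) (uPairsM k N SB NT) :=
    disjoint_sdiff_self_left.mono_right le_sup_right
  have hPM := disjoint_uPairsP_uPairsM (ER := ER) (NT := NT) hk hN hWL hSB
  have hRL := zoneRL_sym2_subset (WL := WL) (ER := ER) (NT := NT) hk hN hSB
  have hTB := zoneTB_sym2_subset (ER := ER) (SB := SB) (NT := NT) hk hN hWL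
  have dAp : DeterminedBy (zdSepOpenPairRE k N ∩ zdSepOpenArmL k N) (↑(uPairsS k N WL ER SB NT) ∪ ↑(uPairsP k N WL ER)) :=
    (determinedBy_zdSepOpenPairRE (Set.subset_union_left.trans hRL)).inter
      (determinedBy_zdSepOpenArmL (Set.subset_union_right.trans hRL))
  have dAm : DeterminedBy (zdSepDualArmT k N ∩ zdSepDualArmB k N) (↑(uPairsS k N WL ER SB NT) ∪ ↑(uPairsM k N SB NT)) :=
    (determinedBy_zdSepDualArmT (Set.subset_union_left.trans hTB)).inter
      (determinedBy_zdSepDualArmB (Set.subset_union_right.trans hTB))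
  have hFKG := bondPercolation_locallyMonotone_fkg (zdGraph 2) half hSP hSM hPM
    (isUpperSet_zdSepOpenPairRE_inter_zdSepOpenArmL _ _) (isLowerSet_zdSepDualArmT_inter_zdSepDualArmB _ _)
    (isUpperSet_uCorrOpen (k := k) (N := N) (WL := WL) (ER := ER)) (isLowerSet_uCorrDual (k := k) (N := N) (SB := SB) (NT := NT))
    dAp dAm determinedBy_uCorrOpen determinedBy_uCorrDual
  -- measurability of the arms-and-corridors event and independence from the hub
  have dX : DeterminedBy (zdSepOpenPairRE k N ∩ zdSepOpenArmL k N ∩ (zdSepDualArmT k N ∩ zdSepDualArmB k N) ∩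
      (uCorrOpen k N WL ER ∩ uCorrDual k N SB NT))
      (↑(uPairsS k N WL ER SB NT) ∪ ↑(uPairsP k N WL ER) ∪ ↑(uPairsM k N SB NT)) :=
    ((dAp.mono Set.subset_union_left).inter (dAm.mono (Set.union_subset_union_left _ Set.subset_union_left))).inter
      ((determinedBy_uCorrOpen.mono (Set.subset_union_right.trans Set.subset_union_left)).inter
        (determinedBy_uCorrDual.mono Set.subset_union_right))
  have hXm : MeasurableSet (zdSepOpenPairRE k N ∩ zdSepOpenArmL k N ∩ (zdSepDualArmT k N ∩ zdSepDualArmB k N) ∩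
      (uCorrOpen k N WL ER ∩ uCorrDual k N SB NT)) := by
    have : (↑(uPairsS k N WL ER SB NT) ∪ ↑(uPairsP k N WL ER) ∪ ↑(uPairsM k N SB NT) : Set (Sym2 (Site 2))) =
        ↑(uPairsS k N WL ER SB NT ∪ uPairsP k N WL ER ∪ uPairsM k N SB NT) := by push_cast; rfl
    rw [this] at dX
    exact dX.measurableSet_of_finset
  have hind := bondPercolation_real_inter_of_disjoint (zdGraph 2) half (disjoint_hubPairs_uPairs (NT := NT) hk hN hWL hSB)
    dX (determinedBy_zdHub (k / 2 - 1) (k / 4) (k / 64)) hXm (measurableSet_zdHub _ _ _)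
  -- the corridor bounds
  have hc0' := hc0.le
  have hBp : c ^ 6 ≤ μ.real (uCorrOpen k N WL ER) := by
    have e6 : c ^ 6 = c * c * c * (c * c * c) := by ring
    rw [e6]
    refine le_real_inter_of_upper (by positivity) (by positivity)
      (((isUpperSet_lrCrossingAt _ _ _).inter (isUpperSet_lrCrossingAt _ _ _)).inter (isUpperSet_lrCrossingAt _ _ _))
      (((isUpperSet_lrCrossingAt _ _ _).inter (isUpperSet_lrCrossingAt _ _ _)).inter (isUpperSet_lrCrossingAt _ _ _))
      (((measurableSet_lrCrossingAt _ _ _).inter (measurableSet_lrCrossingAt _ _ _)).inter (measurableSet_lrCrossingAt _ _ _))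
      (((measurableSet_lrCrossingAt _ _ _).inter (measurableSet_lrCrossingAt _ _ _)).inter (measurableSet_lrCrossingAt _ _ _))
      ?_ ?_
    · refine le_real_inter_of_upper (by positivity) hc0'
        ((isUpperSet_lrCrossingAt _ _ _).inter (isUpperSet_lrCrossingAt _ _ _)) (isUpperSet_lrCrossingAt _ _ _)
        ((measurableSet_lrCrossingAt _ _ _).inter (measurableSet_lrCrossingAt _ _ _)) (measurableSet_lrCrossingAt _ _ _)
        (le_real_inter_of_upper hc0' hc0' (isUpperSet_lrCrossingAt _ _ _) (isUpperSet_lrCrossingAt _ _ _)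
          (measurableSet_lrCrossingAt _ _ _) (measurableSet_lrCrossingAt _ _ _)
          (le_real_lrCrossingAt_of_rsw hc _ (by omega)) (le_real_lrCrossingAt_of_rsw hc _ (by omega)))
        (le_real_lrCrossingAt_of_rsw hc _ (by omega))
    · refine le_real_inter_of_upper (by positivity) hc0'
        ((isUpperSet_lrCrossingAt _ _ _).inter (isUpperSet_lrCrossingAt _ _ _)) (isUpperSet_lrCrossingAt _ _ _)
        ((measurableSet_lrCrossingAt _ _ _).inter (measurableSet_lrCrossingAt _ _ _)) (measurableSet_lrCrossingAt _ _ _)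
        (le_real_inter_of_upper hc0' hc0' (isUpperSet_lrCrossingAt _ _ _) (isUpperSet_lrCrossingAt _ _ _)
          (measurableSet_lrCrossingAt _ _ _) (measurableSet_lrCrossingAt _ _ _)
          (le_real_lrCrossingAt_of_rsw hc _ (by omega)) (le_real_lrCrossingAt_of_rsw hc _ (by omega)))
        (le_real_lrCrossingAt_of_rsw hc _ (by omega))
  have hBm : c ^ 4 * (1 / 2 : ℝ) ^ (2 * (k / 64 + 1)) ≤ μ.real (uCorrDual k N SB NT) := by
    have e4 : c ^ 4 * (1 / 2 : ℝ) ^ (2 * (k / 64 + 1)) =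
        c * c * (c * (1 / 2 : ℝ) ^ (k / 64 + 1) * (c * (1 / 2 : ℝ) ^ (k / 64 + 1))) := by ring
    rw [e4]
    refine le_real_inter_of_lower (by positivity) (by positivity)
      ((isLowerSet_dualFaceCrossing _ _ _).inter (isLowerSet_dualFaceCrossing _ _ _))
      (((isLowerSet_dualFaceCrossing _ _ _).inter (isLowerSet_rowClosed _ _ _)).inter
        ((isLowerSet_dualFaceCrossing _ _ _).inter (isLowerSet_rowClosed _ _ _)))
      ((measurableSet_dualFaceCrossing _ _ _).inter (measurableSet_dualFaceCrossing _ _ _))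
      (((measurableSet_dualFaceCrossing _ _ _).inter (measurableSet_forall_notMem _)).inter
        ((measurableSet_dualFaceCrossing _ _ _).inter (measurableSet_forall_notMem _)))
      (le_real_inter_of_lower hc0' hc0' (isLowerSet_dualFaceCrossing _ _ _) (isLowerSet_dualFaceCrossing _ _ _)
        (measurableSet_dualFaceCrossing _ _ _) (measurableSet_dualFaceCrossing _ _ _)
        (le_real_dualFaceCrossing_of_rsw hc _ (by omega)) (le_real_dualFaceCrossing_of_rsw hc _ (by omega)))
      ?_
    refine le_real_inter_of_lower (by positivity) (by positivity)
      ((isLowerSet_dualFaceCrossing _ _ _).inter (isLowerSet_rowClosed _ _ _))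
      ((isLowerSet_dualFaceCrossing _ _ _).inter (isLowerSet_rowClosed _ _ _))
      ((measurableSet_dualFaceCrossing _ _ _).inter (measurableSet_forall_notMem _))
      ((measurableSet_dualFaceCrossing _ _ _).inter (measurableSet_forall_notMem _)) ?_ ?_
    · exact le_real_inter_of_lower hc0' (by positivity) (isLowerSet_dualFaceCrossing _ _ _) (isLowerSet_rowClosed _ _ _)
        (measurableSet_dualFaceCrossing _ _ _) (measurableSet_forall_notMem _)
        (le_real_dualFaceCrossing_of_rsw hc _ (by omega)) (le_real_rowClosed _ _ _)
    · exact le_real_inter_of_lower hc0' (by positivity) (isLowerSet_dualFaceCrossing _ _ _) (isLowerSet_rowClosed _ _ _)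
        (measurableSet_dualFaceCrossing _ _ _) (measurableSet_forall_notMem _)
        (le_real_dualFaceCrossing_of_rsw hc _ (by omega)) (le_real_rowClosed _ _ _)
  have hHub := le_real_zdHub (k / 2 - 1) (k / 4) (k / 64)
  -- assembly
  have hset : uGluedE k N WL ER SB NT =
      zdSepOpenPairRE k N ∩ zdSepOpenArmL k N ∩ (zdSepDualArmT k N ∩ zdSepDualArmB k N) ∩
        (uCorrOpen k N WL ER ∩ uCorrDual k N SB NT) ∩ zdHub (k / 2 - 1) (k / 4) (k / 64) := rfl
  have hsep : zdFiveArmSepE k N = zdSepOpenPairRE k N ∩ zdSepOpenArmL k N ∩ (zdSepDualArmT k N ∩ zdSepDualArmB k N) := rfl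
  rw [hset, hind, hsep]
  calc c ^ 10 * (1 / 2 : ℝ) ^ (2 * (k / 64 + 1)) * (1 / 2 : ℝ) ^ (hubPairs (k / 2 - 1)).card *
        μ.real (zdSepOpenPairRE k N ∩ zdSepOpenArmL k N ∩ (zdSepDualArmT k N ∩ zdSepDualArmB k N))
      = μ.real (zdSepOpenPairRE k N ∩ zdSepOpenArmL k N ∩ (zdSepDualArmT k N ∩ zdSepDualArmB k N)) *
          (c ^ 6 * (c ^ 4 * (1 / 2 : ℝ) ^ (2 * (k / 64 + 1)))) * (1 / 2 : ℝ) ^ (hubPairs (k / 2 - 1)).card := by ring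
    _ ≤ μ.real (zdSepOpenPairRE k N ∩ zdSepOpenArmL k N ∩ (zdSepDualArmT k N ∩ zdSepDualArmB k N)) *
          (μ.real (uCorrOpen k N WL ER) * μ.real (uCorrDual k N SB NT)) * μ.real (zdHub (k / 2 - 1) (k / 4) (k / 64)) := by
        refine mul_le_mul (mul_le_mul_of_nonneg_left (mul_le_mul hBp hBm (by positivity) measureReal_nonneg)
          measureReal_nonneg) hHub (by positivity) (by positivity)
    _ ≤ _ := mul_le_mul_of_nonneg_right hFKG measureReal_nonneg

end UProbabilityE

/-! ### The open arms of `(U)` in the hub frame, edge-disjoint form -/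

section UOpenArmsE

variable {k N WL ER SB NT : ℕ}

set_option maxHeartbeats 1600000 in
/-- **The three extended open arms of `(U)`, edge-disjoint form** (hub frame): on `uGluedE`, for
lattice configurations, three open walks from the origin to the left side `{x₀ = -WL}` and (twice)
to the right side `{x₀ = ER}` of the target rectangle, inside the slab `{-WL ≤ x₀ ≤ ER, |x₁| ≤ 3N}`,
the two right ones EDGE-disjoint: an edge common to both would be an edge of both edge carriers (hub
edges, inner and outer corridor edges of one arm keep away from the carrier of the other).
[cite: Nolin2008, §4.5, proof of Prop. 17; KestenSidoraviciusZhang1998, (3.10)] -/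
theorem uGluedE_openArms (hk : 128 ≤ k) (hN : 2 * k ≤ N) (hWL : 3 * N ≤ WL) (hER : 3 * N ≤ ER)
    {ω : BondConfig (Site 2)} (hωE : ω ⊆ (zdGraph 2).edgeSet) (hω : ω ∈ uGluedE k N WL ER SB NT) :
    ∃ (l r r' : Site 2) (P₁ : (zdGraph 2).Walk 0 l) (P₃ : (zdGraph 2).Walk 0 r) (P₄ : (zdGraph 2).Walk 0 r'),
      l 0 = -(WL : ℤ) ∧ r 0 = ER ∧ r' 0 = ER ∧
      (∀ z ∈ P₁.support, -(WL : ℤ) ≤ z 0 ∧ z 0 ≤ ER ∧ |z 1| ≤ 3 * N) ∧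
      (∀ z ∈ P₃.support, -(WL : ℤ) ≤ z 0 ∧ z 0 ≤ ER ∧ |z 1| ≤ 3 * N) ∧
      (∀ z ∈ P₄.support, -(WL : ℤ) ≤ z 0 ∧ z 0 ≤ ER ∧ |z 1| ≤ 3 * N) ∧
      (∀ e ∈ P₁.edges, e ∈ ω) ∧ (∀ e ∈ P₃.edges, e ∈ ω) ∧ (∀ e ∈ P₄.edges, e ∈ ω) ∧
      (∀ e ∈ P₃.edges, e ∉ P₄.edges) := by
  obtain ⟨⟨⟨⟨⟨Ap, Am, hdisj⟩, ⟨AL⟩⟩, -, -⟩, ⟨⟨⟨hORp, hORm⟩, hOL⟩, ⟨⟨hIRp, hIRm⟩, hIL⟩⟩, -⟩, hHub⟩ := hω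
  have hk8 : 8 ≤ k := by omega
  have hN8 : 8 ≤ N := by omega
  have hE : 1 ≤ N / 8 := by omega
  have he : 1 ≤ k / 8 := by omega
  have hKa : k / 4 + k / 64 ≤ k / 2 - 1 := by omega
  have hK1 : (((k / 2 - 1 : ℕ) : ℤ)) = (k / 2 : ℕ) - 1 := by omega
  -- zone bounds for carrier sites
  have zoneR_bd : ∀ z ∈ zdSepZoneR k N, |z 0| ≤ (N : ℤ) + (N / 8 : ℕ) + 1 ∧ |z 1| ≤ (N : ℤ) + (N / 8 : ℕ) + 1 :=
    fun z hz => (zone_sites hk hN (Or.inl (Or.inl hz))).1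
  have zoneL_bd : ∀ z ∈ zdSepZoneL k N, |z 0| ≤ (N : ℤ) + (N / 8 : ℕ) + 1 ∧ |z 1| ≤ (N : ℤ) + (N / 8 : ℕ) + 1 :=
    fun z hz => (zone_sites hk hN (Or.inl (Or.inr hz))).1
  have hApZ : Ap.carrier ⊆ zdSepZoneR k N := by
    intro v hv
    rcases Ap.carrier_subset (B := (k / 4 : ℕ) + (k / 64 : ℕ)) (B' := (N / 4 : ℕ) + (N / 64 : ℕ))
      (abs_le.2 ⟨by omega, by omega⟩) (abs_le.2 ⟨by omega, by omega⟩) (abs_le.2 ⟨by omega, by omega⟩)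
      (abs_le.2 ⟨by omega, by omega⟩) hv with h | h | h
    · exact Or.inl h
    · exact Or.inr (Or.inl ⟨h.1, h.2.1, by have := h.2.2; omega⟩)
    · exact Or.inr (Or.inr ⟨h.1, h.2.1, by have := h.2.2; omega⟩)
  have hAmZ : Am.carrier ⊆ zdSepZoneR k N := by
    intro v hv
    rcases Am.carrier_subset (B := (k / 4 : ℕ) + (k / 64 : ℕ)) (B' := (N / 4 : ℕ) + (N / 64 : ℕ))
      (abs_le.2 ⟨by omega, by omega⟩) (abs_le.2 ⟨by omega, by omega⟩) (abs_le.2 ⟨by omega, by omega⟩)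
      (abs_le.2 ⟨by omega, by omega⟩) hv with h | h | h
    · exact Or.inl h
    · exact Or.inr (Or.inl ⟨h.1, h.2.1, by have := h.2.2; omega⟩)
    · exact Or.inr (Or.inr ⟨h.1, h.2.1, by have := h.2.2; omega⟩)
  have hALZ : AL.carrier ⊆ zdSepZoneL k N := by
    intro v hv
    rcases AL.carrier_subset (B := (k / 64 : ℕ)) (B' := (N / 64 : ℕ)) (abs_le.2 ⟨by omega, by omega⟩)
      (abs_le.2 ⟨by omega, by omega⟩) (abs_le.2 ⟨by omega, by omega⟩) (abs_le.2 ⟨by omega, by omega⟩) hv with h | h | h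
    · exact Or.inl h
    · exact Or.inr (Or.inl ⟨h.1, h.2.1, by have := h.2.2; omega⟩)
    · exact Or.inr (Or.inr ⟨h.1, h.2.1, by have := h.2.2; omega⟩)
  -- ### the upper right arm
  obtain ⟨xo, yo, To, hxo, hyo, hTos, hToe⟩ := exists_walk_of_mem_lrCrossingAt hωE hORp
  obtain ⟨xi, yi, Ti, hxi, hyi, hTis, hTie⟩ := exists_walk_of_mem_lrCrossingAt hωE hIRp
  simp only [Matrix.cons_val_zero, Matrix.cons_val_one] at hxo hyo hTos hxi hyi hTis
  obtain ⟨mo, hmo, Uo, hUos, hUoE, hUoe⟩ := Ap.exists_walk_of_outerCorridorE' rfl hE To hxo (by rw [hyo]; omega)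
    (fun z hz => ⟨(hTos z hz).1, fun _ => ⟨(hTos z hz).2.2.1, (hTos z hz).2.2.2⟩⟩)
  obtain ⟨mi, hmi, Ui, hUis, hUiE, hUie⟩ := Ap.exists_walk_of_innerCorridorE' rfl he Ti (by rw [hyi]; omega) (by rw [hxi]; omega)
    (fun z hz => ⟨by have := (hTis z hz).2.1; omega, fun _ => ⟨(hTis z hz).2.2.1, (hTis z hz).2.2.2⟩⟩)
  have hxi1 := (hTis xi Ti.start_mem_support).2.2
  obtain ⟨tip, HW, htip0, htip1, hHWs, hHWe⟩ := exists_hubWalkRpos (k / 2 - 1) (k / 4) (k / 64) (t := xi 1) hxi1.1 hxi1.2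
  obtain rfl : tip = xi := LatticeModels.Site.eq_iff_two.2 ⟨by rw [htip0, hxi]; omega, htip1⟩
  obtain ⟨P₃, hP₃e, hP₃s, hP₃E⟩ := exists_composedArmE HW Ti hmi Ui Uo To hmo
    (fun e he' => mem_of_mem_zdHub_of_mem_hubOpen hKa hHub (hHWe e he')) hTie hUie hUoe hToe
  -- ### the lower right arm
  obtain ⟨xo', yo', To', hxo', hyo', hTos', hToe'⟩ := exists_walk_of_mem_lrCrossingAt hωE hORm
  obtain ⟨xi', yi', Ti', hxi', hyi', hTis', hTie'⟩ := exists_walk_of_mem_lrCrossingAt hωE hIRm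
  simp only [Matrix.cons_val_zero, Matrix.cons_val_one] at hxo' hyo' hTos' hxi' hyi' hTis'
  obtain ⟨mo', hmo', Uo', hUos', hUoE', hUoe'⟩ := Am.exists_walk_of_outerCorridorE' (by omega) hE To' hxo'
    (by rw [hyo']; omega) (fun z hz => ⟨(hTos' z hz).1, fun _ => ⟨(hTos' z hz).2.2.1, by have := (hTos' z hz).2.2.2; omega⟩⟩)
  obtain ⟨mi', hmi', Ui', hUis', hUiE', hUie'⟩ := Am.exists_walk_of_innerCorridorE' (by omega) he Ti'
    (by rw [hyi']; omega) (by rw [hxi']; omega)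
    (fun z hz => ⟨by have := (hTis' z hz).2.1; omega, fun _ => ⟨(hTis' z hz).2.2.1, by have := (hTis' z hz).2.2.2; omega⟩⟩)
  have hxi1' := (hTis' xi' Ti'.start_mem_support).2.2
  obtain ⟨tip', HW', htip0', htip1', hHWs', hHWe'⟩ := exists_hubWalkRneg (k / 2 - 1) (k / 4) (k / 64) (t := xi' 1)
    (by have := hxi1'.1; omega) (by have := hxi1'.2; omega)
  obtain rfl : tip' = xi' := LatticeModels.Site.eq_iff_two.2 ⟨by rw [htip0', hxi']; omega, htip1'⟩
  obtain ⟨P₄, hP₄e, hP₄s, hP₄E⟩ := exists_composedArmE HW' Ti' hmi' Ui' Uo' To' hmo'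
    (fun e he' => mem_of_mem_zdHub_of_mem_hubOpen hKa hHub (hHWe' e he')) hTie' hUie' hUoe' hToe'
  -- ### the left arm
  obtain ⟨xl, yl, Tl, hxl, hyl, hTls, hTle⟩ := exists_walk_of_mem_lrCrossingAt hωE hOL
  obtain ⟨xj, yj, Tj, hxj, hyj, hTjs, hTje⟩ := exists_walk_of_mem_lrCrossingAt hωE hIL
  simp only [Matrix.cons_val_zero, Matrix.cons_val_one] at hxl hyl hTls hxj hyj hTjs
  obtain ⟨ml, hml, Ul, hUls, hUle⟩ := AL.exists_walk_of_outerCorridor' (by omega) hE Tl.reverse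
    (by rw [hyl]; omega) (by rw [hxl]; omega)
    (fun z hz => by
      rw [Walk.support_reverse, List.mem_reverse] at hz
      exact ⟨by have := (hTls z hz).2.1; omega, fun _ => ⟨(hTls z hz).2.2.1, by have := (hTls z hz).2.2.2; omega⟩⟩)
  obtain ⟨mj, hmj, Uj, hUjs, hUje⟩ := AL.exists_walk_of_innerCorridor' (by omega) he Tj.reverse
    hxj (by rw [hyj]; omega)
    (fun z hz => by
      rw [Walk.support_reverse, List.mem_reverse] at hz
      exact ⟨by have := (hTjs z hz).1; omega, fun _ => ⟨(hTjs z hz).2.2.1, by have := (hTjs z hz).2.2.2; omega⟩⟩)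
  have hyj1 := (hTjs yj Tj.end_mem_support).2.2
  obtain ⟨tipl, HWl, htipl0, htipl1, hHWls, hHWle⟩ := exists_hubWalkL (k / 2 - 1) (k / 4) (k / 64) (t := yj 1)
    hyj1.1 (by have := hyj1.2; omega)
  obtain rfl : tipl = yj := LatticeModels.Site.eq_iff_two.2 ⟨by rw [htipl0, hyj]; omega, htipl1⟩
  have hmj' : mj ∈ Tj.reverse.support := hmj
  have hml' : ml ∈ Tl.reverse.support := hml
  obtain ⟨P₁, hP₁e, hP₁s⟩ := exists_composedArm HWl Tj.reverse hmj' Uj Ul Tl.reverse hml'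
    (fun e he' => mem_of_mem_zdHub_of_mem_hubOpen hKa hHub (hHWle e he'))
    (fun e he' => hTje e (by simpa using he')) hUje hUle (fun e he' => hTle e (by simpa using he'))
  -- ### supports
  have annR : ∀ z ∈ sqAnnulus k N, |z 0| ≤ N ∧ |z 1| ≤ N ∧ ((k : ℤ) ≤ |z 0| ∨ (k : ℤ) ≤ |z 1|) := by
    intro z hz
    rw [mem_sqAnnulus_iff (by omega), Fin.forall_fin_two, Fin.exists_fin_two] at hz
    obtain ⟨⟨h0, h1⟩, h2⟩ := hz
    refine ⟨abs_le.2 ⟨h0.1, h0.2⟩, abs_le.2 ⟨h1.1, h1.2⟩, ?_⟩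
    rcases h2 with h2 | h2 <;> [left; right] <;> rw [le_abs] <;> omega
  refine ⟨xl, yo, yo', P₁, P₃, P₄, hxl, by rw [hyo]; omega, by rw [hyo']; omega, fun z hz => ?_, fun z hz => ?_,
    fun z hz => ?_, hP₁e, hP₃e, hP₄e, fun ε hε₃ hε₄ => ?_⟩
  · rcases hP₁s z hz with h | h | h | h | h
    · rcases hHWls z h with h | h | h <;> exact ⟨by omega, by omega, abs_le.2 ⟨by omega, by omega⟩⟩
    · rw [Walk.support_reverse, List.mem_reverse] at h
      have := hTjs z h; exact ⟨by omega, by omega, abs_le.2 ⟨by omega, by omega⟩⟩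
    · have := zoneL_bd z (hALZ (hUjs z h))
      have e0 := abs_le.1 this.1
      exact ⟨by omega, by omega, by have := this.2; omega⟩
    · have := zoneL_bd z (hALZ (hUls z h))
      have e0 := abs_le.1 this.1
      exact ⟨by omega, by omega, by have := this.2; omega⟩
    · rw [Walk.support_reverse, List.mem_reverse] at h
      have := hTls z h; exact ⟨by omega, by omega, abs_le.2 ⟨by omega, by omega⟩⟩
  · rcases hP₃s z hz with h | h | h | h | h
    · rcases hHWs z h with h | h | h | h <;> exact ⟨by omega, by omega, abs_le.2 ⟨by omega, by omega⟩⟩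
    · have := hTis z h; exact ⟨by omega, by omega, abs_le.2 ⟨by omega, by omega⟩⟩
    · have := zoneR_bd z (hApZ (hUis z h))
      have e0 := abs_le.1 this.1
      exact ⟨by omega, by omega, by have := this.2; omega⟩
    · have := zoneR_bd z (hApZ (hUos z h))
      have e0 := abs_le.1 this.1
      exact ⟨by omega, by omega, by have := this.2; omega⟩
    · have := hTos z h; exact ⟨by omega, by omega, abs_le.2 ⟨by omega, by omega⟩⟩
  · rcases hP₄s z hz with h | h | h | h | h
    · rcases hHWs' z h with h | h | h | h <;> exact ⟨by omega, by omega, abs_le.2 ⟨by omega, by omega⟩⟩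
    · have := hTis' z h; exact ⟨by omega, by omega, abs_le.2 ⟨by omega, by omega⟩⟩
    · have := zoneR_bd z (hAmZ (hUis' z h))
      have e0 := abs_le.1 this.1
      exact ⟨by omega, by omega, by have := this.2; omega⟩
    · have := zoneR_bd z (hAmZ (hUos' z h))
      have e0 := abs_le.1 this.1
      exact ⟨by omega, by omega, by have := this.2; omega⟩
    · have := hTos' z h; exact ⟨by omega, by omega, abs_le.2 ⟨by omega, by omega⟩⟩
  · -- ### edge-disjointness of the two right arms
    -- classification of the sites of `P₃`: origin / positive non-annulus / carrier of `Ap`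
    have c3 : ∀ z ∈ P₃.support, z = 0 ∨ (0 < z 1 ∧ z ∉ sqAnnulus k N) ∨ z ∈ Ap.carrier := by
      intro z hz₃
      rcases hP₃s z hz₃ with h | h | h | h | h
      · rcases hHWs z h with h | h | h | h
        · rcases eq_or_lt_of_le h.2.1 with h1 | h1
          · left; exact LatticeModels.Site.eq_iff_two.2 ⟨h.1, h1.symm⟩
          · right; left; refine ⟨h1, fun ha => ?_⟩; have := (annR z ha).2.2; rw [le_abs, le_abs] at this; omega
        all_goals
          right; left; refine ⟨by omega, fun ha => ?_⟩
          have := (annR z ha).2.2; rw [le_abs, le_abs] at this; omega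
      · right; left
        have := hTis z h
        refine ⟨by omega, fun ha => ?_⟩
        have := (annR z ha).2.2; rw [le_abs, le_abs] at this; omega
      · exact Or.inr (Or.inr (hUis z h))
      · exact Or.inr (Or.inr (hUos z h))
      · right; left
        have := hTos z h
        refine ⟨by omega, fun ha => ?_⟩
        have := (annR z ha).1; rw [abs_le] at this; omega
    have c4 : ∀ z ∈ P₄.support, z = 0 ∨ (z 1 < 0 ∧ z ∉ sqAnnulus k N) ∨ z ∈ Am.carrier := by
      intro z hz₄
      rcases hP₄s z hz₄ with h | h | h | h | h
      · rcases hHWs' z h with h | h | h | h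
        · rcases eq_or_lt_of_le h.2.2 with h1 | h1
          · left; exact LatticeModels.Site.eq_iff_two.2 ⟨h.1, h1⟩
          · right; left; refine ⟨h1, fun ha => ?_⟩; have := (annR z ha).2.2; rw [le_abs, le_abs] at this; omega
        all_goals
          right; left; refine ⟨by omega, fun ha => ?_⟩
          have := (annR z ha).2.2; rw [le_abs, le_abs] at this; omega
      · right; left
        have := hTis' z h
        refine ⟨by omega, fun ha => ?_⟩
        have := (annR z ha).2.2; rw [le_abs, le_abs] at this; omega
      · exact Or.inr (Or.inr (hUis' z h))
      · exact Or.inr (Or.inr (hUos' z h))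
      · right; left
        have := hTos' z h
        refine ⟨by omega, fun ha => ?_⟩
        have := (annR z ha).1; rw [abs_le] at this; omega
    have sp : ∀ v ∈ Ap.carrier, v ∈ sqAnnulus k N ∨ 0 < v 1 := by
      intro v hv
      rcases Ap.carrier_cases hk8 hN8 hv with h | h | h
      · exact Or.inl h
      · right; omega
      · right; omega
    have sm : ∀ v ∈ Am.carrier, v ∈ sqAnnulus k N ∨ v 1 < 0 := by
      intro v hv
      rcases Am.carrier_cases hk8 hN8 hv with h | h | h
      · exact Or.inl h
      · right; omega
      · right; omega
    -- hub sites and corridor sites of one right arm are off the carrier of the other (and of itself)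
    have hubP : ∀ z ∈ HW.support, z ∉ Ap.carrier := by
      intro z h hv
      rcases Ap.carrier_cases hk8 hN8 hv with ha | ha | ha
      · have := (annR z ha).2.2; rw [le_abs, le_abs] at this
        rcases hHWs z h with h | h | h | h <;> omega
      · rcases hHWs z h with h | h | h | h <;> omega
      · rcases hHWs z h with h | h | h | h <;> omega
    have hubM : ∀ z ∈ HW'.support, z ∉ Am.carrier := by
      intro z h hv
      rcases Am.carrier_cases hk8 hN8 hv with ha | ha | ha
      · have := (annR z ha).2.2; rw [le_abs, le_abs] at this
        rcases hHWs' z h with h | h | h | h <;> omega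
      · rcases hHWs' z h with h | h | h | h <;> omega
      · rcases hHWs' z h with h | h | h | h <;> omega
    have TiM : ∀ z ∈ Ti.support, z ∉ Am.carrier := by
      intro z h hv
      have := hTis z h
      rcases Am.carrier_cases hk8 hN8 hv with ha | ha | ha
      · have := (annR z ha).2.2; rw [le_abs, le_abs] at this; omega
      · omega
      · omega
    have ToM : ∀ z ∈ To.support, z ∉ Am.carrier := by
      intro z h hv
      have := hTos z h
      rcases Am.carrier_cases hk8 hN8 hv with ha | ha | ha
      · have := (annR z ha).1; rw [abs_le] at this; omega
      · omega
      · omega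
    have TiP : ∀ z ∈ Ti'.support, z ∉ Ap.carrier := by
      intro z h hv
      have := hTis' z h
      rcases Ap.carrier_cases hk8 hN8 hv with ha | ha | ha
      · have := (annR z ha).2.2; rw [le_abs, le_abs] at this; omega
      · omega
      · omega
    have ToP : ∀ z ∈ To'.support, z ∉ Ap.carrier := by
      intro z h hv
      have := hTos' z h
      rcases Ap.carrier_cases hk8 hN8 hv with ha | ha | ha
      · have := (annR z ha).1; rw [abs_le] at this; omega
      · omega
      · omega
    -- an endpoint of the common edge off the origin
    have key : ∀ z ∈ ε, z ≠ 0 → False := by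
      intro z hz hz0
      have hz₃ : z ∈ P₃.support := forall_mem_support_of_mem_edges P₃ hε₃ z hz
      have hz₄ : z ∈ P₄.support := forall_mem_support_of_mem_edges P₄ hε₄ z hz
      rcases c3 z hz₃ with h3 | h3 | h3
      · exact hz0 h3
      · rcases c4 z hz₄ with h4 | h4 | h4
        · exact hz0 h4
        · omega
        · rcases sm z h4 with h | h
          · exact h3.2 h
          · omega
      · rcases c4 z hz₄ with h4 | h4 | h4
        · exact hz0 h4
        · rcases sp z h3 with h | h
          · exact h4.2 h
          · omega
        · -- `z` is on both carriers: the common edge is on both edge carriers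
          have hA : ε ∈ Ap.edgeCarrier := by
            rcases hP₃E ε hε₃ with h | h | h | h | h
            · exact absurd h3 (hubP z (forall_mem_support_of_mem_edges HW h z hz))
            · exact absurd h4 (TiM z (forall_mem_support_of_mem_edges Ti h z hz))
            · exact hUiE ε h
            · exact hUoE ε h
            · exact absurd h4 (ToM z (forall_mem_support_of_mem_edges To h z hz))
          have hB : ε ∈ Am.edgeCarrier := by
            rcases hP₄E ε hε₄ with h | h | h | h | h
            · exact absurd h4 (hubM z (forall_mem_support_of_mem_edges HW' h z hz))
            · exact absurd h3 (TiP z (forall_mem_support_of_mem_edges Ti' h z hz))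
            · exact hUiE' ε h
            · exact hUoE' ε h
            · exact absurd h3 (ToP z (forall_mem_support_of_mem_edges To' h z hz))
          exact Set.disjoint_left.1 hdisj hA hB
    induction ε using Sym2.ind with
    | h x y =>
      have hxy : x ≠ y := (P₃.adj_of_mem_edges hε₃).ne
      by_cases hx0 : x = 0
      · exact key y (Sym2.mem_mk_right x y) fun hy0 => hxy (hx0.trans hy0.symm)
      · exact key x (Sym2.mem_mk_left x y) hx0

end UOpenArmsE

/-! ### The dual arms of `(U)` from their ingredients -/

section UDualArmsE

variable {k N WL ER SB NT : ℕ}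

/-- **The two extended dual arms of `(U)` from their ingredients** (hub frame; the statement of
`uGlued_dualArms` under exactly what its proof uses — the two fenced dual arms, the dual corridors
with the closed rows, the hub): a walk of faces from the face `(-1, 0)` north-west of the origin UP to
the top face row `{f₁ = NT}` and one from the face `(-1, -1)` south-west of the origin DOWN to the
bottom face row `{f₁ = -SB-1}`, all of whose steps cross closed edges, inside
`{|f₀| ≤ 3N - 1, -SB-1 ≤ f₁ ≤ NT}`. [cite: Nolin2008, §4.5, proof of Prop. 17; KestenSidoraviciusZhang1998, (3.10)] -/
theorem uGlued_dualArms_of_parts (hk : 128 ≤ k) (hN : 2 * k ≤ N) (hSB : 3 * N ≤ SB) (hNT : 3 * N ≤ NT)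
    {ω : BondConfig (Site 2)}
    (hω : ω ∈ (zdSepDualArmT k N ∩ zdSepDualArmB k N) ∩ uCorrDual k N SB NT ∩ zdHub (k / 2 - 1) (k / 4) (k / 64)) :
    ∃ (t s : Site 2) (Q₂ : (zdGraph 2).Walk ![-1, 0] t) (Q₅ : (zdGraph 2).Walk ![-1, -1] s),
      t 1 = NT ∧ s 1 = -(SB : ℤ) - 1 ∧
      (∀ z ∈ Q₂.support, |z 0| + 1 ≤ 3 * N ∧ -(SB : ℤ) - 1 ≤ z 1 ∧ z 1 ≤ NT) ∧
      (∀ z ∈ Q₅.support, |z 0| + 1 ≤ 3 * N ∧ -(SB : ℤ) - 1 ≤ z 1 ∧ z 1 ≤ NT) ∧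
      (∀ d ∈ Q₂.darts, sepEdge d.fst d.snd ∉ ω) ∧ (∀ d ∈ Q₅.darts, sepEdge d.fst d.snd ∉ ω) := by
  obtain ⟨⟨⟨⟨AT⟩, ⟨AB⟩⟩, ⟨hOT, hOB⟩, ⟨hIT, hRT⟩, hIB, hRB⟩, hHub⟩ := hω
  have hE : 1 ≤ N / 8 := by omega
  have he : 1 ≤ k / 8 := by omega
  have haK : ((k / 4 : ℕ) : ℤ) + 1 ≤ ((k / 2 - 1 : ℕ) : ℤ) := by omega
  have hhK : ((k / 64 : ℕ) : ℤ) + 1 ≤ ((k / 2 - 1 : ℕ) : ℤ) := by omega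
  have hub_closed : ∀ e, e ∈ hubPairs (k / 2 - 1) ∧ e ∉ hubOpen (k / 2 - 1) (k / 4) (k / 64) → e ∉ ω :=
    fun e ⟨h1, h2⟩ h3 => h2 ((hHub e h1).1 h3)
  -- ### top
  obtain ⟨a, b, W, ha, hb, hWs, hWd⟩ := hOT
  obtain ⟨a', b', W', ha', hb', hW's, hW'd⟩ := hIT
  simp only [Matrix.cons_val_zero, Matrix.cons_val_one] at ha hb hWs ha' hb' hW's
  obtain ⟨mT, hmT, UT, hUTs, hUTc⟩ := AT.exists_faceWalk_of_outerCorridor' (by omega) hE W.reverse (by rw [hb]; omega)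
    (by rw [ha]; omega)
    (fun z hz => by
      rw [Walk.support_reverse, List.mem_reverse] at hz
      exact ⟨by have := (hWs z hz).2.2.1; omega, fun _ => ⟨(hWs z hz).1, by have := (hWs z hz).2.1; omega⟩⟩)
  obtain ⟨m'T, hm'T, U'T, hU'Ts, hU'Tc⟩ := AT.exists_faceWalk_of_innerCorridor' (by omega) he W'.reverse
    (by rw [ha']; omega) (by rw [hb']; omega)
    (fun z hz => by
      rw [Walk.support_reverse, List.mem_reverse] at hz
      exact ⟨by have := (hW's z hz).2.2.2; omega, fun _ => ⟨(hW's z hz).1, by have := (hW's z hz).2.1; omega⟩⟩)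
  rw [Walk.support_reverse, List.mem_reverse] at hmT hm'T
  have hb'0 := (hW's b' W'.end_mem_support)
  obtain ⟨fT, UhT, hfT0, hfT1, hUhTs, hUhTd⟩ := exists_hubDualPathT (k / 2 - 1) (k / 4) (k / 64) haK hhK
    (b := b' 0) hb'0.1 (by have := hb'0.2.1; omega)
  have hb'eq : b' = fT + Pi.single 1 1 :=
    LatticeModels.Site.eq_iff_two.2 ⟨by simp [hfT0], by simp [hfT1, hb']; omega⟩
  have hstepT : (zdGraph 2).Adj b' fT := by rw [hb'eq]; exact adj_of_stepKind (.down (by simp) (by simp))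
  have hsepT : sepEdge b' fT ∉ ω := by
    rw [hb'eq, sepEdge_down_eq, ← hb'eq]
    exact hRT _ (mk_add_single_zero_mem_rowEdges (by omega) hb'0.1 (by have := hb'0.2.1; omega))
  obtain ⟨Q₂r, hQ₂d, hQ₂s⟩ := exists_composedDualArm (W.takeUntil mT hmT) UT U'T (W'.dropUntil m'T hm'T) hstepT UhT
    (fun d hd => hWd d (W.darts_takeUntil_subset_darts hmT hd)) hUTc hU'Tc
    (fun d hd => hW'd d (W'.darts_dropUntil_subset_darts hm'T hd)) hsepT (fun d hd => hub_closed _ (hUhTd d hd))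
  -- ### bottom
  obtain ⟨a₃, b₃, W₃, ha₃, hb₃, hW₃s, hW₃d⟩ := hOB
  obtain ⟨a'', b'', W'', ha'', hb'', hW''s, hW''d⟩ := hIB
  simp only [Matrix.cons_val_zero, Matrix.cons_val_one] at ha₃ hb₃ hW₃s ha'' hb'' hW''s
  obtain ⟨mB, hmB, UB, hUBs, hUBc⟩ := AB.exists_faceWalk_of_outerCorridor' (by omega) hE W₃ (by rw [ha₃]; omega)
    (by rw [hb₃]; omega)
    (fun z hz => ⟨by have := (hW₃s z hz).2.2.2; omega, fun _ => ⟨(hW₃s z hz).1, by have := (hW₃s z hz).2.1; omega⟩⟩)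
  obtain ⟨m'B, hm'B, U'B, hU'Bs, hU'Bc⟩ := AB.exists_faceWalk_of_innerCorridor' (by omega) he W''
    (by rw [hb'']; omega) (by rw [ha'']; omega)
    (fun z hz => ⟨by have := (hW''s z hz).2.2.1; omega, fun _ => ⟨(hW''s z hz).1, by have := (hW''s z hz).2.1; omega⟩⟩)
  have ha''0 := (hW''s a'' W''.start_mem_support)
  obtain ⟨fB, UhB, hfB0, hfB1, hUhBs, hUhBd⟩ := exists_hubDualPathB (k / 2 - 1) (k / 4) (k / 64) haK hhK
    (b := a'' 0) ha''0.1 (by have := ha''0.2.1; omega)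
  have hfBeq : fB = a'' + Pi.single 1 1 :=
    LatticeModels.Site.eq_iff_two.2 ⟨by simp [hfB0], by simp [hfB1, ha'']; omega⟩
  have hstepB : (zdGraph 2).Adj fB a'' := by rw [hfBeq]; exact adj_of_stepKind (.down (by simp) (by simp))
  have hsepB : sepEdge fB a'' ∉ ω := by
    rw [hfBeq, sepEdge_down_eq, ← hfBeq]
    exact hRB _ (mk_add_single_zero_mem_rowEdges (x := fB) (by omega) (by rw [hfB0]; exact ha''0.1)
      (by rw [hfB0]; have := ha''0.2.1; omega))
  -- assemble the bottom walk directly: hub path, step, inner corridor to the meeting point, inner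
  -- gluing walk (reversed), outer gluing walk, outer corridor from the meeting point
  have hk1 : 1 ≤ k := by omega
  have hkN : k ≤ N := by omega
  refine ⟨a, b₃, Q₂r.reverse,
    UhB.append (Walk.cons hstepB ((W''.takeUntil m'B hm'B).append (U'B.reverse.append (UB.append (W₃.dropUntil mB hmB))))),
    ha.trans (by omega), hb₃.trans (by omega), fun z hz => ?_, fun z hz => ?_, ?_, fun d hd => ?_⟩
  · rw [Walk.support_reverse, List.mem_reverse] at hz
    rcases hQ₂s z hz with h | h | h | h | h
    · have := hWs z (W.support_takeUntil_subset_support hmT h)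
      exact ⟨by rw [abs_of_nonneg this.1]; omega, by omega, by omega⟩
    · have := AT.face_bounds hk1 hkN (by omega) (by omega) (by omega) (by omega) (Or.inl (hUTs z h))
      have e0 := abs_le.1 this.1
      exact ⟨by have h' : |z 0| ≤ 3 * (N : ℤ) - 1 := abs_le.2 ⟨by omega, by omega⟩; omega, by omega, by omega⟩
    · have := AT.face_bounds hk1 hkN (by omega) (by omega) (by omega) (by omega) (Or.inr (hU'Ts z h))
      have e0 := abs_le.1 this.1
      exact ⟨by have h' : |z 0| ≤ 3 * (N : ℤ) - 1 := abs_le.2 ⟨by omega, by omega⟩; omega, by omega, by omega⟩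
    · have := hW's z (W'.support_dropUntil_subset_support hm'T h)
      exact ⟨by rw [abs_of_nonneg this.1]; omega, by omega, by omega⟩
    · have := hUhTs z h
      exact ⟨by have h' : |z 0| ≤ 3 * (N : ℤ) - 1 := abs_le.2 ⟨by omega, by omega⟩; omega, by omega, by omega⟩
  · simp only [Walk.mem_support_append_iff, Walk.support_cons, List.mem_cons, Walk.support_reverse,
      List.mem_reverse] at hz
    rcases hz with h | rfl | h | h | h | h
    · have := hUhBs z h
      exact ⟨by have h' : |z 0| ≤ 3 * (N : ℤ) - 1 := abs_le.2 ⟨by omega, by omega⟩; omega, by omega, by omega⟩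
    · exact ⟨by have h' : |z 0| ≤ 3 * (N : ℤ) - 1 := abs_le.2 ⟨by omega, by omega⟩; omega, by omega, by omega⟩
    · have := hW''s z (W''.support_takeUntil_subset_support hm'B h)
      exact ⟨by rw [abs_of_nonneg this.1]; omega, by omega, by omega⟩
    · have := AB.face_bounds hk1 hkN (by omega) (by omega) (by omega) (by omega) (Or.inr (hU'Bs z h))
      have e0 := abs_le.1 this.1
      exact ⟨by have h' : |z 0| ≤ 3 * (N : ℤ) - 1 := abs_le.2 ⟨by omega, by omega⟩; omega, by omega, by omega⟩
    · have := AB.face_bounds hk1 hkN (by omega) (by omega) (by omega) (by omega) (Or.inl (hUBs z h))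
      have e0 := abs_le.1 this.1
      exact ⟨by have h' : |z 0| ≤ 3 * (N : ℤ) - 1 := abs_le.2 ⟨by omega, by omega⟩; omega, by omega, by omega⟩
    · have := hW₃s z (W₃.support_dropUntil_subset_support hmB h)
      exact ⟨by rw [abs_of_nonneg this.1]; omega, by omega, by omega⟩
  · exact sepEdge_forall_darts_reverse (P := fun e => e ∉ ω) hQ₂d
  · simp only [Walk.darts_append, List.mem_append, Walk.darts_cons, List.mem_cons, Walk.darts_reverse,
      List.mem_reverse, List.mem_map] at hd
    rcases hd with hd | rfl | hd | ⟨d', hd', rfl⟩ | hd | hd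
    · exact hub_closed _ (hUhBd d hd)
    · exact hsepB
    · exact hW''d d (W''.darts_takeUntil_subset_darts hm'B hd)
    · rw [sepEdge_dart_symm]; exact hU'Bc d' hd'
    · exact hUBc d hd
    · exact hW₃d d (W₃.darts_dropUntil_subset_darts hmB hd)

end UDualArmsE

/-! ### `(U)`: the glued event is a translate of KSZ's landed event with edge-disjoint right arms -/

section UKSZE

variable {k N WL ER SB NT : ℕ}

/-- **The landed five-arm event with edge-disjoint right arms from five arms**: at a vertex `v`
with `1 ≤ v₀ ≤ M - 1` carrying a closed lattice edge, three open lattice walks inside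
`R = [0, M] × [0, N]` from `v` to the left side and (twice) to the right side, the two right ones
edge-disjoint, together with two face walks of the dual rectangle crossing CLOSED edges, from faces
around `v` to the top face row and to the bottom face row, give `zdFiveArmKSZ3 M N v` (the two dual
arms are joined through the faces around `v`, `ZdFiveArmKSZ.exists_cornerWalk`).
[cite: KestenSidoraviciusZhang1998, proof of Lemma 5, (3.10)] [cite: Nolin2008, §5.2, proof of Thm. 24 (arXiv 0711.4948: p. 16, the event A_v)] -/
theorem mem_zdFiveArmKSZ3_of_arms {M N : ℕ} {ω : BondConfig (Site 2)} {v u l r r' f g t s : Site 2}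
    (hv0 : 1 ≤ v 0) (hv0' : v 0 + 1 ≤ M) (hu : (zdGraph 2).Adj v u) (huc : s(v, u) ∉ ω)
    (P₁ : (zdGraph 2).Walk v l) (P₃ : (zdGraph 2).Walk v r) (P₄ : (zdGraph 2).Walk v r')
    (hl : l 0 = 0) (hr : r 0 = M) (hr' : r' 0 = M)
    (hs₁ : ∀ z ∈ P₁.support, (0 : ℤ) ≤ z 0 ∧ z 0 ≤ M ∧ (0 : ℤ) ≤ z 1 ∧ z 1 ≤ N)
    (hs₃ : ∀ z ∈ P₃.support, (0 : ℤ) ≤ z 0 ∧ z 0 ≤ M ∧ (0 : ℤ) ≤ z 1 ∧ z 1 ≤ N)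
    (hs₄ : ∀ z ∈ P₄.support, (0 : ℤ) ≤ z 0 ∧ z 0 ≤ M ∧ (0 : ℤ) ≤ z 1 ∧ z 1 ≤ N)
    (he₁ : ∀ e ∈ P₁.edges, e ∈ ω) (he₃ : ∀ e ∈ P₃.edges, e ∈ ω) (he₄ : ∀ e ∈ P₄.edges, e ∈ ω)
    (h₃₄ : ∀ e ∈ P₃.edges, e ∉ P₄.edges)
    (hf : f ∈ cornerFaces v) (hg : g ∈ cornerFaces v)
    (Q₂ : (zdGraph 2).Walk f t) (ht : t 1 = N)
    (hQ₂s : ∀ z ∈ Q₂.support, (0 : ℤ) ≤ z 0 ∧ z 0 + 1 ≤ M ∧ (-1 : ℤ) ≤ z 1 ∧ z 1 ≤ N)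
    (hQ₂c : ∀ d ∈ Q₂.darts, sepEdge d.fst d.snd ∉ ω)
    (Q₅ : (zdGraph 2).Walk g s) (hs : s 1 = -1)
    (hQ₅s : ∀ z ∈ Q₅.support, (0 : ℤ) ≤ z 0 ∧ z 0 + 1 ≤ M ∧ (-1 : ℤ) ≤ z 1 ∧ z 1 ≤ N)
    (hQ₅c : ∀ d ∈ Q₅.darts, sepEdge d.fst d.snd ∉ ω) :
    ω ∈ zdFiveArmKSZ3 M N v := by
  have hv := hs₁ v P₁.start_mem_support
  obtain ⟨J, hJ⟩ := ZdFiveArmKSZ.exists_cornerWalk hf hg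
  refine ⟨hv0', ⟨u, hu, huc⟩, l, r, r', P₁, P₃, P₄, hl, hr, hr', hs₁, hs₃, hs₄, he₁, he₃, he₄, h₃₄, t, s,
    Q₂.reverse.append (J.append Q₅), ht, hs, fun z hz => ?_, fun d hd => ?_⟩
  · rw [Walk.mem_support_append_iff, Walk.support_reverse, List.mem_reverse,
      Walk.mem_support_append_iff] at hz
    rcases hz with hz | hz | hz
    · exact hQ₂s z hz
    · exact ZdFiveArmKSZ.cornerFaces_bounds (hJ z hz) hv0 hv0' hv.2.2.1 hv.2.2.2
    · exact hQ₅s z hz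
  · rw [Walk.darts_append, List.mem_append, Walk.mem_darts_reverse, Walk.darts_append,
      List.mem_append] at hd
    rcases hd with hd | hd | hd
    · left
      rw [show sepEdge d.fst d.snd = sepEdge d.symm.fst d.symm.snd from sepEdge_comm _ _]
      exact hQ₂c _ hd
    · exact Or.inr ⟨hJ _ (J.dart_fst_mem_support_of_mem_darts hd),
        hJ _ (J.dart_snd_mem_support_of_mem_darts hd)⟩
    · exact Or.inl (hQ₅c d hd)

/-- **The closed edge of the hub at the origin**: on the hub event, the horizontal edge
`{(0,0), (1,0)}` (a forced pair off the open comb, `k ≥ 128`) is closed — the origin has exactly the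
three open edges of the spine and of the row `0`. [folklore] -/
theorem not_mem_of_mem_zdHub_origin_right (hk : 128 ≤ k) {ω : BondConfig (Site 2)}
    (hω : ω ∈ zdHub (k / 2 - 1) (k / 4) (k / 64)) :
    s((0 : Site 2), (0 : Site 2) + Pi.single 0 1) ∉ ω := by
  intro h
  have hpair : s((0 : Site 2), (0 : Site 2) + Pi.single 0 1) ∈ hubPairs (k / 2 - 1) :=
    mem_hubPairs_of_adj ((SimpleGraph.mem_edgeSet _).1 (single_edge_mem (0 : Site 2) 0))
      (Or.inl (by rw [mem_box]; intro i; simp))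
  have hopen := (hω _ hpair).1 h
  rw [mk_add_single_zero_mem_hubOpen_iff] at hopen
  simp only [Pi.zero_apply] at hopen
  omega

/-- **On `uGluedE`, KSZ's landed five-arm event with edge-disjoint right arms holds at `v = (WL, SB)`
for the shifted configuration**, in the rectangle `[0, WL + ER] × [0, SB + NT]`: the three extended
open arms (the right ones edge-disjoint, hence so after `bypass` and translation) and the two extended
dual arms of the hub frame, translated by `v`; the closed edge at `v` is the translate of the forced
closed hub pair `{(0,0), (1,0)}`.  No left–right disjointness is needed. [cite: KestenSidoraviciusZhang1998, proof of Lemma 5, (3.10)] [cite: Nolin2008, §4.5 Prop. 17 and §5.2 Thm. 24] -/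
theorem relabel_shift_mem_zdFiveArmKSZ3_of_mem_uGluedE (hk : 128 ≤ k) (hN : 2 * k ≤ N)
    (hWL : 3 * N ≤ WL) (hER : 3 * N ≤ ER) (hSB : 3 * N ≤ SB) (hNT : 3 * N ≤ NT)
    {ω : BondConfig (Site 2)} (hωE : ω ⊆ (zdGraph 2).edgeSet) (hω : ω ∈ uGluedE k N WL ER SB NT) :
    BondConfig.relabel (sym2Equiv (Site.shift (![(WL : ℤ), SB] : Site 2))) ω ∈
      zdFiveArmKSZ3 (WL + ER) (SB + NT) ![(WL : ℤ), SB] := by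
  set v : Site 2 := ![(WL : ℤ), SB] with hv
  set φ := (zdShiftIso v).toHom with hφ
  set ω' := BondConfig.relabel (sym2Equiv (Site.shift v)) ω with hω'
  have hv0 : v 0 = WL := by simp [hv]
  have hv1 : v 1 = SB := by simp [hv]
  have hN1 : 1 ≤ N := by omega
  obtain ⟨l, r, r', P₁, P₃, P₄, hl, hr, hr', hs₁, hs₃, hs₄, he₁, he₃, he₄, h₃₄⟩ :=
    uGluedE_openArms hk hN hWL hER hωE hω
  have hparts : ω ∈ (zdSepDualArmT k N ∩ zdSepDualArmB k N) ∩ uCorrDual k N SB NT ∩ zdHub (k / 2 - 1) (k / 4) (k / 64) :=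
    ⟨⟨hω.1.1.2, hω.1.2.2⟩, hω.2⟩
  obtain ⟨t, s, Q₂, Q₅, ht, hs, hQ₂s, hQ₅s, hQ₂c, hQ₅c⟩ := uGlued_dualArms_of_parts hk hN hSB hNT hparts
  have hclosed := not_mem_of_mem_zdHub_origin_right hk hω.2
  -- translation of the data
  have Eopen : ∀ {c d : Site 2} (P : (zdGraph 2).Walk c d), (∀ e ∈ P.edges, e ∈ ω) →
      ∀ e ∈ (P.map φ).edges, e ∈ ω' := by
    intro c d P hP e he
    obtain ⟨e', he', rfl⟩ := mem_edges_map_shift he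
    exact (map_add_mem_relabel_shift_iff v ω e').2 (hP e' he')
  have Eclosed : ∀ {c d : Site 2} (Q : (zdGraph 2).Walk c d), (∀ dd ∈ Q.darts, sepEdge dd.fst dd.snd ∉ ω) →
      ∀ dd ∈ (Q.map φ).darts, sepEdge dd.fst dd.snd ∉ ω' := by
    intro c d Q hQ dd hdd
    obtain ⟨d', hd', h1, h2⟩ := mem_darts_map_shift hdd
    rw [h1, h2, KSTPeriodic.sepEdge_add_right, hω', map_add_mem_relabel_shift_iff]
    exact hQ d' hd'
  have Esupp : ∀ {c d : Site 2} (P : (zdGraph 2).Walk c d),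
      (∀ z ∈ P.support, -(WL : ℤ) ≤ z 0 ∧ z 0 ≤ ER ∧ |z 1| ≤ 3 * N) →
      ∀ z ∈ (P.map φ).support, (0 : ℤ) ≤ z 0 ∧ z 0 ≤ ((WL + ER : ℕ) : ℤ) ∧ (0 : ℤ) ≤ z 1 ∧ z 1 ≤ ((SB + NT : ℕ) : ℤ) := by
    intro c d P hP z hz
    have h := hP _ (mem_support_map_shift.1 hz)
    simp only [Pi.sub_apply, hv0, hv1] at h
    have e1 := abs_le.1 h.2.2
    push_cast
    omega
  -- the three open paths
  set R₁ := ((P₁.map φ).copy (zero_add v) rfl).bypass with hR₁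
  set R₃ := ((P₃.map φ).copy (zero_add v) rfl).bypass with hR₃
  set R₄ := ((P₄.map φ).copy (zero_add v) rfl).bypass with hR₄
  have sR₁ : ∀ z ∈ R₁.support, z ∈ (P₁.map φ).support := fun z hz => by
    have := Walk.support_bypass_subset_support _ hz; rwa [Walk.support_copy] at this
  have sR₃ : ∀ z ∈ R₃.support, z ∈ (P₃.map φ).support := fun z hz => by
    have := Walk.support_bypass_subset_support _ hz; rwa [Walk.support_copy] at this
  have sR₄ : ∀ z ∈ R₄.support, z ∈ (P₄.map φ).support := fun z hz => by
    have := Walk.support_bypass_subset_support _ hz; rwa [Walk.support_copy] at this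
  have eR₃' : ∀ e ∈ R₃.edges, e ∈ (P₃.map φ).edges := fun e he => by
    have := Walk.edges_bypass_subset_edges _ he; rwa [Walk.edges_copy] at this
  have eR₄' : ∀ e ∈ R₄.edges, e ∈ (P₄.map φ).edges := fun e he => by
    have := Walk.edges_bypass_subset_edges _ he; rwa [Walk.edges_copy] at this
  have eR₁ : ∀ e ∈ R₁.edges, e ∈ ω' := fun e he => by
    have := Walk.edges_bypass_subset_edges _ he; rw [Walk.edges_copy] at this; exact Eopen P₁ he₁ e this
  have eR₃ : ∀ e ∈ R₃.edges, e ∈ ω' := fun e he => Eopen P₃ he₃ e (eR₃' e he)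
  have eR₄ : ∀ e ∈ R₄.edges, e ∈ ω' := fun e he => Eopen P₄ he₄ e (eR₄' e he)
  have hl' : (φ l) 0 = 0 := by simp [hφ, hv0, hl]
  have hr0 : (φ r) 0 = ((WL + ER : ℕ) : ℤ) := by simp [hφ, hv0, hr]; ring
  have hr0' : (φ r') 0 = ((WL + ER : ℕ) : ℤ) := by simp [hφ, hv0, hr']; ring
  -- edge-disjointness of the translated right paths
  have h₃₄' : ∀ e ∈ R₃.edges, e ∉ R₄.edges := by
    intro e he₃' he₄'
    obtain ⟨e₃, he₃, rfl⟩ := mem_edges_map_shift (eR₃' e he₃')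
    obtain ⟨e₄, he₄, heq⟩ := mem_edges_map_shift (eR₄' _ he₄')
    have hinj : Function.Injective (fun x : Site 2 => x + v) := add_left_injective v
    have : e₃ = e₄ := Sym2.map.injective hinj heq
    exact h₃₄ e₃ he₃ (this ▸ he₄)
  -- the faces around `v` and the closed edge at `v`
  have hfNW : φ ![-1, 0] ∈ cornerFaces v := add_mem_cornerFaces (by rw [mem_cornerFaces_iff]; simp) v
  have hfSW : φ ![-1, -1] ∈ cornerFaces v := add_mem_cornerFaces (by rw [mem_cornerFaces_iff]; simp) v
  have ht' : (φ t) 1 = ((SB + NT : ℕ) : ℤ) := by simp [hφ, hv1, ht]; ring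
  have hs' : (φ s) 1 = -1 := by simp [hφ, hv1, hs]; ring
  have hQs : ∀ {c d : Site 2} (Q : (zdGraph 2).Walk c d),
      (∀ z ∈ Q.support, |z 0| + 1 ≤ 3 * N ∧ -(SB : ℤ) - 1 ≤ z 1 ∧ z 1 ≤ NT) →
      ∀ z ∈ (Q.map φ).support, (0 : ℤ) ≤ z 0 ∧ z 0 + 1 ≤ ((WL + ER : ℕ) : ℤ) ∧ (-1 : ℤ) ≤ z 1 ∧ z 1 ≤ ((SB + NT : ℕ) : ℤ) := by
    intro c d Q hQ z hz
    have h := hQ _ (mem_support_map_shift.1 hz)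
    simp only [Pi.sub_apply, hv0, hv1] at h
    have e1 := abs_le.1 (show |z 0 - WL| ≤ 3 * N - 1 by have := h.1; omega)
    push_cast
    omega
  have hvv : 1 ≤ v 0 ∧ v 0 + 1 ≤ ((WL + ER : ℕ) : ℤ) ∧ 0 ≤ v 1 ∧ v 1 ≤ ((SB + NT : ℕ) : ℤ) := by
    rw [hv0, hv1]; push_cast; omega
  have hadj : (zdGraph 2).Adj v (v + Pi.single 0 1) := (SimpleGraph.mem_edgeSet _).1 (single_edge_mem v 0)
  have hclosed' : s(v, v + Pi.single 0 1) ∉ ω' := by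
    have : s(v, v + Pi.single 0 1) = Sym2.map (· + v) s((0 : Site 2), (0 : Site 2) + Pi.single 0 1) := by
      rw [Sym2.map_mk]
      show s(v, v + Pi.single 0 1) = s(0 + v, 0 + Pi.single 0 1 + v)
      rw [zero_add, zero_add, add_comm]
    rw [this, hω', map_add_mem_relabel_shift_iff]
    exact hclosed
  exact mem_zdFiveArmKSZ3_of_arms hvv.1 hvv.2.1 hadj hclosed' R₁ R₃ R₄ hl' hr0 hr0'
    (fun z hz => Esupp P₁ hs₁ z (sR₁ z hz)) (fun z hz => Esupp P₃ hs₃ z (sR₃ z hz)) (fun z hz => Esupp P₄ hs₄ z (sR₄ z hz))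
    eR₁ eR₃ eR₄ h₃₄' hfNW hfSW (Q₂.map φ) ht' (hQs Q₂ hQ₂s) (Eclosed Q₂ hQ₂c) (Q₅.map φ) hs' (hQs Q₅ hQ₅s)
    (Eclosed Q₅ hQ₅c)

end UKSZE

/-! ### `(U)`: the point upper bound from separation with edge-disjoint right arms -/

section UPointBoundE

open _root_.MeasureTheory

variable {k N : ℕ}

/-- **KSZ's counting bound for the well-separated event with edge-disjoint right arms**: for
`128 ≤ k`, `2k ≤ N` and the RSW constant `c` of aspect ratio `1024`,
`(2N+1)² · c¹⁰ 2^{-2(k/64+1)} 2^{-|hubPairs|} · P(zdFiveArmSepE k N) ≤ 1` — the translates of the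
glued event by the `(2N+1)²` vectors `v ∈ [3N, 5N]²` are contained in the pairwise disjoint events
`zdFiveArmKSZ3 (8N) (8N) v`. [cite: KestenSidoraviciusZhang1998, proof of Lemma 5, (3.11)] [cite: Nolin2008, §5.2, proof of Thm. 24] -/
theorem real_zdFiveArmSepE_mul_le_one (hk : 128 ≤ k) (hN : 2 * k ≤ N) {c : ℝ} (hc0 : 0 < c)
    (hc : ∀ l : ℕ, 1 ≤ l → c ≤ crossingProb half (1024 * l - 1) (l - 1)) :
    (2 * (N : ℝ) + 1) ^ 2 * (c ^ 10 * (1 / 2 : ℝ) ^ (2 * (k / 64 + 1)) * (1 / 2 : ℝ) ^ (hubPairs (k / 2 - 1)).card) *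
        (bondPercolation (zdGraph 2) half).real (zdFiveArmSepE k N) ≤ 1 := by
  classical
  set μ := bondPercolation (zdGraph 2) half with hμ
  set b := c ^ 10 * (1 / 2 : ℝ) ^ (2 * (k / 64 + 1)) * (1 / 2 : ℝ) ^ (hubPairs (k / 2 - 1)).card with hb
  set I := Finset.Icc (3 * N) (5 * N) with hI
  set emb : ℕ × ℕ → Site 2 := fun q => ![(q.1 : ℤ), q.2] with hemb
  have hinj : Function.Injective emb := by
    intro q q' h
    have h0 := congrFun h 0
    have h1 := congrFun h 1
    simp only [hemb, Matrix.cons_val_zero, Matrix.cons_val_one, Nat.cast_inj] at h0 h1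
    exact Prod.ext h0 h1
  set V := (I ×ˢ I).image emb with hV
  have hcard : V.card = (2 * N + 1) ^ 2 := by
    rw [hV, Finset.card_image_of_injective _ hinj, Finset.card_product, hI, Nat.card_Icc]
    have : 5 * N + 1 - 3 * N = 2 * N + 1 := by omega
    rw [this, pow_two]
  have hsum := sum_real_zdFiveArmKSZ3_le_one μ (8 * N) (8 * N) V
  have hterm : ∀ v ∈ V, b * μ.real (zdFiveArmSepE k N) ≤ μ.real (zdFiveArmKSZ3 (8 * N) (8 * N) v) := by
    intro v hv
    rw [hV, Finset.mem_image] at hv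
    obtain ⟨⟨WL, SB⟩, hq, rfl⟩ := hv
    rw [Finset.mem_product, hI, Finset.mem_Icc, Finset.mem_Icc] at hq
    obtain ⟨⟨hWL, hWL'⟩, ⟨hSB, hSB'⟩⟩ := hq
    have hglue := real_uGluedE_ge (WL := WL) (ER := 8 * N - WL) (SB := SB) (NT := 8 * N - SB) hk hN hWL hWL'
      (by omega) (by omega) hSB hSB' (by omega) hc0 hc
    have hM : WL + (8 * N - WL) = 8 * N := by omega
    have hNr : SB + (8 * N - SB) = 8 * N := by omega
    have hincl : uGluedE k N WL (8 * N - WL) SB (8 * N - SB) ∩ {ω | ω ⊆ (zdGraph 2).edgeSet} ⊆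
        BondConfig.relabel (sym2Equiv (Site.shift (emb (WL, SB)))) ⁻¹' zdFiveArmKSZ3 (8 * N) (8 * N) (emb (WL, SB)) := by
      rintro ω ⟨hω, hωE⟩
      have := relabel_shift_mem_zdFiveArmKSZ3_of_mem_uGluedE hk hN hWL (by omega) hSB (by omega) hωE hω
      rw [hM, hNr] at this
      exact this
    calc b * μ.real (zdFiveArmSepE k N) ≤ μ.real (uGluedE k N WL (8 * N - WL) SB (8 * N - SB)) := hglue
      _ ≤ μ.real (BondConfig.relabel (sym2Equiv (Site.shift (emb (WL, SB)))) ⁻¹' zdFiveArmKSZ3 (8 * N) (8 * N) (emb (WL, SB))) := by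
          refine ENNReal.toReal_mono (measure_ne_top _ _) (measure_mono_ae ?_)
          filter_upwards [ae_subset_edgeSet (zdGraph 2) half] with ω hωE hω
          exact hincl ⟨hω, hωE⟩
      _ = μ.real (zdFiveArmKSZ3 (8 * N) (8 * N) (emb (WL, SB))) := bondPercolation_real_preimage_shift _ _ _
  have hle : ∑ v ∈ V, b * μ.real (zdFiveArmSepE k N) ≤ ∑ v ∈ V, μ.real (zdFiveArmKSZ3 (8 * N) (8 * N) v) :=
    Finset.sum_le_sum hterm
  rw [Finset.sum_const, hcard, nsmul_eq_mul] at hle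
  push_cast at hle
  linarith

/-- **The point upper bound `(U)` from Kesten's separation theorem, edge-disjoint form.** If, for
some `c > 0` and `n₀`, `c · P(zdFiveArmClusters n N) ≤ P(zdFiveArmSepE n N)` whenever `n₀ ≤ n` and
`2n ≤ N` (Kesten 1987, Lemmas 4–5; Nolin 2008, Thm. 11 with Prop. 12, for the two right arms only
edge-disjoint), then for `k = max n₀ 128` there is `C` with `P(zdFiveArmClusters k N) ≤ C / N²` for
all `N ≥ k` (KSZ 1998, Lemma 5; Nolin 2008, Thm. 24 (3)). [cite: KestenSidoraviciusZhang1998, Lemma 5] [cite: Nolin2008, §5.2, Thm. 24] -/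
theorem zdFiveArm_pointBound_of_separationE
    (hsep : ∃ c : ℝ, 0 < c ∧ ∃ n₀ : ℕ, ∀ n N : ℕ, n₀ ≤ n → 2 * n ≤ N →
      c * (bondPercolation (zdGraph 2) half).real (zdFiveArmClusters n N) ≤
        (bondPercolation (zdGraph 2) half).real (zdFiveArmSepE n N)) :
    ∃ k : ℕ, 128 ≤ k ∧ ∃ C : ℝ, ∀ N : ℕ, k ≤ N →
      (bondPercolation (zdGraph 2) half).real (zdFiveArmClusters k N) ≤ C / (N : ℝ) ^ 2 := by
  obtain ⟨cs, hcs, n₀, hsep⟩ := hsep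
  obtain ⟨c, hc0, hc⟩ := rsw_lowerBound_holds 1024 (by norm_num)
  set k := max n₀ 128 with hk
  have hk128 : 128 ≤ k := le_max_right _ _
  have hkn₀ : n₀ ≤ k := le_max_left _ _
  set b := c ^ 10 * (1 / 2 : ℝ) ^ (2 * (k / 64 + 1)) * (1 / 2 : ℝ) ^ (hubPairs (k / 2 - 1)).card with hb
  have hb0 : 0 < b := by positivity
  refine ⟨k, hk128, 1 / (4 * cs * b) + 4 * (k : ℝ) ^ 2, fun N hkN => ?_⟩
  set μ := bondPercolation (zdGraph 2) half with hμ
  have hN0 : (0 : ℝ) < N := by exact_mod_cast (show 0 < N by omega)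
  have hN2 : (0 : ℝ) < (N : ℝ) ^ 2 := by positivity
  rw [le_div_iff₀ hN2]
  have hk0 : 0 ≤ 4 * (k : ℝ) ^ 2 := by positivity
  have h4 : 0 ≤ 1 / (4 * cs * b) := by positivity
  by_cases h2 : 2 * k ≤ N
  · have h1 := real_zdFiveArmSepE_mul_le_one hk128 h2 hc0 hc
    rw [← hb] at h1
    have hs := hsep k N hkn₀ h2
    have hA : 4 * (N : ℝ) ^ 2 ≤ (2 * (N : ℝ) + 1) ^ 2 := by nlinarith [hN0]
    have hP : μ.real (zdFiveArmClusters k N) * (N : ℝ) ^ 2 ≤ 1 / (4 * cs * b) := by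
      rw [le_div_iff₀ (by positivity)]
      calc μ.real (zdFiveArmClusters k N) * (N : ℝ) ^ 2 * (4 * cs * b)
          = 4 * (N : ℝ) ^ 2 * b * (cs * μ.real (zdFiveArmClusters k N)) := by ring
        _ ≤ 4 * (N : ℝ) ^ 2 * b * μ.real (zdFiveArmSepE k N) :=
            mul_le_mul_of_nonneg_left hs (by positivity)
        _ ≤ (2 * (N : ℝ) + 1) ^ 2 * b * μ.real (zdFiveArmSepE k N) :=
            mul_le_mul_of_nonneg_right (mul_le_mul_of_nonneg_right hA hb0.le) measureReal_nonneg
        _ ≤ 1 := h1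
    linarith [hP, hk0]
  · have h2' := not_le.1 h2
    have hle1 : μ.real (zdFiveArmClusters k N) ≤ 1 := measureReal_le_one
    have hNk : (N : ℝ) < 2 * k := by exact_mod_cast h2'
    have h3 : (N : ℝ) ^ 2 ≤ 4 * (k : ℝ) ^ 2 := by nlinarith [hNk, hN0]
    calc μ.real (zdFiveArmClusters k N) * (N : ℝ) ^ 2 ≤ 1 * (4 * (k : ℝ) ^ 2) :=
          mul_le_mul hle1 h3 hN2.le zero_le_one
      _ ≤ 1 / (4 * cs * b) + 4 * (k : ℝ) ^ 2 := by linarith [h4]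

end UPointBoundE

end Literature.Probability.Percolation

end
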